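import Summits.Ventures.CertifiedManyBodySolver.Theses.TcThermcert1
import Literature.MathematicalPhysics.QuantumLattice.HubbardNNNHoppingFluxThermal
import Literature.MathematicalPhysics.QuantumLattice.FermionLiebRobinson
import Literature.MathematicalPhysics.QuantumLattice.LatticeTori
import HarnessLib

/-!
# Crux idea `gauge-qbp-far-seam` — SKETCH (planner hubbard-floor-idea-rescuer g11; crux-ideate on
K1′ = `TcThermcert1.ThermalStiffnessCeilingU8b8_le_7o44` (stmt-Ventures-24560) and K1 =
`TcThermcert1.ThermalStiffnessCeilingU8b10_le_1o8` (stmt-Ventures-26381))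

HONEST FRAMING. KT-type CEILINGS under a hypothesis; nothing here is a lower bound on `T_c`, a number of
record, or a proof of superconductivity in the Hubbard model. The hypothesis `CurrentClustering` is a BET.

THE LEVER (gauge relocation × quantum-belief-propagation local stability).
* GAUGE: the flux `θ` of the seam-twisted torus is locally pure gauge. Conjugating by the sector-preserving
  diagonal unitary `exp(iθ N_{strip})` moves the seam from the column cut `0` to the antipodal cut `⌊L/2⌋`
  without changing the sector partition function, and stationarity of the Gibbs state
  (`⟨[H, N_{strip}]⟩ = 0`) makes the persistent current `I_L(β,φ) = -β⁻¹ ∂_φ log Z_L(β,φ)` equal to the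
  expectation of the PLAIN cut current through column `0` in the state whose seam sits at `⌊L/2⌋`
  (`farCutCurrent`). Hence `log Z_L(β,0) − log Z_L(β,θ) = β ∫₀^θ I_L(β,φ) dφ` and K1′ follows from
  `sup_{|φ| ≤ θ₁} |I_L(8,φ)| → 0` through the PROVED socket `leafAtBeta_of_twistInsensitiveAt` (any `c ≥ 0`).
* QBP: `I_L(β,φ) = Σ_y [⟨j_{(0,y)}⟩_{H₀ + W_φ} − ⟨j_{(0,y)}⟩_{H₀}]` (`⟨j⟩_{H₀} = 0`, time reversal), where
  `W_φ = seamTwistAt ⌊L/2⌋ φ` is supported at torus distance `≥ ⌊L/2⌋ − 1` from the bond and has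
  `‖W_φ‖ ≤ 4 L |sin(φ/2)| ≤ 2 L |φ|`. Capel–Moscolari–Teufel–Wessel, CMP 406 (2025) = arXiv:2310.09182,
  Thm 14 ("LPPL from correlations in the UNPERTURBED state"; fermionic version §5 remark p. 12):
  `|⟨B⟩_{H+V} − ⟨B⟩_H| ≤ e^{2β‖V‖} ‖B‖ Cov_{ρ_β(H)}(X_r ; Y) + 4β‖V‖‖B‖ ζ_QBP(X, r)`, proved by the exact
  intertwiner `e^{−β(H+V)} = η e^{−βH} η*` (Hastings 2007, arXiv:0706.4094), its Lieb–Robinson localisation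
  `η_r` (tree: `fermion_lieb_robinson_hamiltonianWith`) and ONE covariance `Cov_ρ(η_r* η_r, B)` in the
  flux-FREE state. `η` conserves `N↑, N↓`, so the identity restricts to the canonical sector verbatim.
* BUDGET: with `r = L/4`, `|I_L(β,φ)| ≤ 2L·[e^{4βL|φ|} · C L^{2k} e^{−L/(4ξ)} + 8βL|φ| ζ(L/4)] → 0` for
  `|φ| ≤ θ₁ := 1/(64 β ξ)` — the exponential cost `e^{2β‖V‖}` that killed the round-3 note
  «exponentiated seam perturbation / QBP stability (e^{βtL})» (hub-tc-therm-idea-3 r2 NOTES l.32) is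
  `e^{4βLφ}`, NOT `e^{βtL}`: it is proportional to the flux, and the leaf socket consumes the flux premise at
  ONE positive twist as small as we please (`Disproof.k1_false_without_theta0_pos/_fluxPremise` honoured).

`lean check` target: rc 0, sorries ONLY in `stub_twistCost_of_farCutCurrent` (M, exact finite-dimensional
identities) and `stub_farCutCurrent_of_clustering` (L, the CMTW port); `K1prime_of_currentClustering` and
`K1_of_currentClustering` conclude the route decls BY NAME from the hypothesis.
-/

noncomputable section

namespace Summit.Ventures.CertifiedManyBodySolver.Cruxes.ThermalStiffnessCeilingU8b10_le_1o8.GaugeQBP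

open Filter Topology Set Real Matrix
open Literature.MathematicalPhysics.QuantumLattice
open Literature.Probability.LatticeModels
open Summit.Ventures.CertifiedManyBodySolver.Observables
open scoped Matrix.Norms.L2Operator ComplexOrder ComplexConjugate

/-! ## §0 Objects -/

section Objects

variable (L : ℕ) [NeZero L]

/-- Operators on the fermionic Fock space of the two-spin torus `(ℤ/Lℤ)²` (Jordan–Wigner coordinates). -/
abbrev FockOp : Type := Matrix (Finset (Orb (FermionTorus 2 L))) (Finset (Orb (FermionTorus 2 L))) ℂ

/-- The canonical `(N_L, S^z = 0)` coordinate sector at hole density `δ` — verbatim the binder inside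
`thermalFluxLogZ` (`N_L = 2⌊(1-δ)L²/2⌋`). -/
abbrev sectorPred (δ : ℝ) : Finset (Orb (FermionTorus 2 L)) → Prop :=
  fun s => s.card = 2 * ⌊(1 - δ) * (L : ℝ) ^ 2 / 2⌋₊ ∧
    2 * (s.filter fun i => (ofLex i).2 = 0).card = 2 * ⌊(1 - δ) * (L : ℝ) ^ 2 / 2⌋₊

/-- Sector-preserving operator: no matrix element between the sector and its complement
(e.g. every polynomial in `c†_{iσ} c_{jσ}`). -/
def SectorPreserving (δ : ℝ) (A : FockOp L) : Prop :=
  ∀ s t, sectorPred L δ s → ¬ sectorPred L δ t → A s t = 0 ∧ A t s = 0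

/-- Expectation of (the sector compression of) `A` in the canonical Gibbs state of (the sector compression
of) the Fock Hamiltonian `H` at inverse temperature `β`. -/
def sectorExpect (δ β : ℝ) (H A : FockOp L) : ℂ :=
  gibbsState β (H.toBlock (sectorPred L δ) (sectorPred L δ)) (A.toBlock (sectorPred L δ) (sectorPred L δ))

/-- The seam twist RELOCATED to the column cut `{x₁ = X - 1} → {x₁ = X}` (`seamTwist L θ` is `X = 0`):
`Σ_{y,σ} (1 − e^{iθ}) c†_{(X,y)σ} c_{(X−1,y)σ} + (1 − e^{−iθ}) c†_{(X−1,y)σ} c_{(X,y)σ}`. -/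
def seamTwistAt (X : ZMod L) (θ : ℝ) : FockOp L :=
  ∑ y : ZMod L, ∑ σ : Fin 2, ∑ b : Bool,
    (1 - Complex.exp ((if b then 1 else -1) * Complex.I * θ)) •
      (creation (orb (FermionTorus.ofTorusSite ![if b then X else X - 1, y]) σ) *
        annihilation (orb (FermionTorus.ofTorusSite ![if b then X - 1 else X, y]) σ))

/-- The flux-`θ` Hubbard torus (`t = 1`, `t′ = 0`) with its seam at the column cut `X`;
`fluxHamAt L 0 U θ = hubbardTorusTT'Flux L 0 U θ` (stub A(i)). -/
def fluxHamAt (X : ZMod L) (U θ : ℝ) : FockOp L :=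
  hubbardTorusTT' L 1 0 U + seamTwistAt L X θ

/-- The PLAIN (untwisted, `t = 1`) bond current on `(X−1,y) → (X,y)`, both spins:
`j = Σ_σ (−i c†_{(X,y)σ} c_{(X−1,y)σ} + i c†_{(X−1,y)σ} c_{(X,y)σ})`. -/
def bondCurrent (X y : ZMod L) : FockOp L :=
  ∑ σ : Fin 2,
    ((-Complex.I) • (creation (orb (FermionTorus.ofTorusSite ![X, y]) σ) *
        annihilation (orb (FermionTorus.ofTorusSite ![X - 1, y]) σ)) +
      Complex.I • (creation (orb (FermionTorus.ofTorusSite ![X - 1, y]) σ) *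
        annihilation (orb (FermionTorus.ofTorusSite ![X, y]) σ)))

/-- The antipodal column `⌊L/2⌋`. -/
def antipode : ZMod L := ((L / 2 : ℕ) : ZMod L)

/-- **Far-cut persistent current** `I_L(β,φ)`: the plain current through the cut `X = 0`, summed over the
`L` bonds, in the canonical Gibbs state of the torus whose flux seam sits at the ANTIPODAL cut. By gauge
covariance and stationarity this is `−β⁻¹ ∂_φ thermalFluxLogZ L 0 U (1−n) β φ` (stub A(ii)). -/
def farCutCurrent (U n β φ : ℝ) : ℝ :=
  ∑ y : ZMod L, (sectorExpect L (1 - n) β (fluxHamAt L (antipode L) U φ) (bondCurrent L 0 y)).re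

end Objects

/-! ## §1 The hypothesis (THE BET) and the intermediate statement -/

/-- **Hypothesis C — uniform exponential clustering of the flux-FREE canonical sector Gibbs state at `β`
AGAINST THE CUT CURRENTS.** For all large `L`, every even (`carEvenSubalgebra`) sector-preserving observable
`A` supported on a site set `X` at torus (sup-)distance `≥ d` from the bond `(−1,y)–(0,y)` has connected
correlation with the plain bond current `j_{(0,y)}` bounded by `C ‖A‖ |X|^k e^{−d/ξ}`, in the Gibbs state of
`hubbardTorusTT'Flux L 0 U 0` (`=` the translation-invariant `t–U` torus, the seam term vanishes at `θ = 0`)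
compressed to the `(N_L, S^z=0)` sector, `N_L = 2⌊nL²/2⌋`. This is exactly the ONE covariance
`Cov_{ρ₀}(η_r^* η_r ; j)` that Capel–Moscolari–Teufel–Wessel Thm 14 consumes (Def. 1 form, `|X|`-polynomial
growth, FLUX-FREE state only — no twisted state, no complex parameter). It is deliberately NOT stated for a
general second observable `B`: canonical density–density covariances carry the Lebowitz–Percus `−χ/L²`
plateau, whereas every `N`-cumulant correction against the time-reversal-ODD current vanishes
(`⟨j⟩_{GC,μ} ≡ 0`). (`⟨j_{(0,y)}⟩_{ρ₀} = 0` exactly by time reversal, so the covariance is `⟨A j⟩`.) -/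
def CurrentClustering (U n β ξ : ℝ) : Prop :=
  0 < ξ ∧ ∃ C : ℝ, ∃ k L₀ : ℕ, ∀ (L : ℕ) [NeZero L], L₀ ≤ L →
    ∀ (X : Finset (FermionTorus 2 L)) (A : FockOp L),
      A ∈ carEvenSubalgebra (orbSet X) → SectorPreserving L (1 - n) A →
      ∀ (y : ZMod L) (d : ℕ),
        (∀ x ∈ X, d ≤ torusDist x.toTorusSite ![(0 : ZMod L), y] ∧
          d ≤ torusDist x.toTorusSite ![(-1 : ZMod L), y]) →
        ‖sectorExpect L (1 - n) β (hubbardTorusTT'Flux L 0 U 0) (A * bondCurrent L 0 y)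
            - sectorExpect L (1 - n) β (hubbardTorusTT'Flux L 0 U 0) A
              * sectorExpect L (1 - n) β (hubbardTorusTT'Flux L 0 U 0) (bondCurrent L 0 y)‖
          ≤ C * ‖A‖ * (X.card : ℝ) ^ k * Real.exp (-(d : ℝ) / ξ)

/-- **Vanishing far-cut persistent current** on the flux window `|φ| ≤ θ₁`, uniformly: `|I_L(β,φ)| ≤ ε_L → 0`. -/
def PersistentCurrentVanishes (U n β θ₁ : ℝ) : Prop :=
  ∃ ε : ℕ → ℝ, Tendsto ε atTop (𝓝 0) ∧ ∃ L₀ : ℕ, ∀ (L : ℕ) [NeZero L], L₀ ≤ L →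
    ∀ φ : ℝ, |φ| ≤ θ₁ → |farCutCurrent L U n β φ| ≤ ε L

/-! ## §2 The socket (copied VERBATIM from `Lines/zerofree_corridor.lean` §Sockets, PROVED there and here) -/

/-- Qualitative twist-insensitivity of the `(N_L, S^z=0)` sector free energy at inverse temperature `β`. -/
def TwistInsensitiveAt (tp U n β : ℝ) : Prop :=
  ∃ θ₁ : ℝ, 0 < θ₁ ∧ ∃ ε : ℕ → ℝ, Tendsto ε atTop (𝓝 0) ∧ ∃ L₀ : ℕ,
    ∀ (L : ℕ) [NeZero L], L₀ ≤ L → ∀ θ : ℝ, |θ| ≤ θ₁ →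
      |thermalFluxLogZ L tp U (1 - n) β 0 - thermalFluxLogZ L tp U (1 - n) β θ| ≤ ε L

/-- **Socket (PROVED).** Twist-insensitivity at `β > 0` forces the single-temperature leaf for every `c ≥ 0`
(the flux premise is consumed at the positive twist `θ = min θ₀ θ₁`). -/
theorem leafAtBeta_of_twistInsensitiveAt {tp U n β : ℝ} (hβ : 0 < β) {c : ℚ} (_hc : 0 ≤ c)
    (h : TwistInsensitiveAt tp U n β) : ObsThermalStiffnessSeqCeilingAtBeta tp U n β c := by
  intro ρs θ₀ hρs hθ₀ Ls hLs hst
  obtain ⟨θ₁, hθ₁, ε, hε, L₀, hins⟩ := h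
  exfalso
  set θ : ℝ := min θ₀ θ₁ with hθdef
  have hθpos : 0 < θ := lt_min hθ₀ hθ₁
  have hθ0 : |θ| ≤ θ₀ := by rw [abs_of_pos hθpos]; exact min_le_left _ _
  have hθ1 : |θ| ≤ θ₁ := by rw [abs_of_pos hθpos]; exact min_le_right _ _
  have hev : ∀ᶠ j in atTop, β * ρs * θ ^ 2 ≤ ε (Ls j) := by
    have h1 : ∀ᶠ j in atTop, max 1 L₀ ≤ Ls j := hLs.eventually (eventually_ge_atTop (max 1 L₀))
    filter_upwards [h1] with j hj
    haveI : NeZero (Ls j) := ⟨by omega⟩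
    have ha := hst j θ hθ0
    have hb := hins (Ls j) (le_of_max_le_right hj) θ hθ1
    exact ha.trans ((le_abs_self _).trans hb)
  have hlim : Tendsto (fun j => ε (Ls j)) atTop (𝓝 0) := hε.comp hLs
  have hle : β * ρs * θ ^ 2 ≤ 0 := ge_of_tendsto hlim hev
  have hpos : 0 < β * ρs * θ ^ 2 := by positivity
  linarith

/-! ## §3 The two stubs of the eventual line -/

/-- **STUB A (gauge relocation + stationarity; size M; exact finite-dimensional identities).**
(i) `fluxHamAt L 0 U θ = hubbardTorusTT'Flux L 0 U θ` and, for every cut `X`, the sector partition functions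
of `fluxHamAt L X U θ` and `fluxHamAt L 0 U θ` agree (conjugation by the diagonal, sector-preserving unitary
`exp(iθ Σ_{0 ≤ x₁ < X} n_x)`, cf. `trace_pow_toBlock_diagonal_conj` of the K1 line §Gauge);
(ii) `θ ↦ thermalFluxLogZ L 0 U (1−n) β θ` is differentiable with derivative `−β · farCutCurrent L U n β θ`
(`∂_θ log tr_p e^{−βH(θ)} = −β ⟨∂_θ H⟩`, then `⟨J^{twisted}_{⌊L/2⌋}⟩ = ⟨J^{plain}_0⟩` because
`⟨[H, N_{strip}]⟩_{Gibbs} = 0` and `i[H, N_{strip}] = J_{in} − J_{out}`);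
(iii) the mean-value theorem on `[0, θ]`. Why it might fail: only by a typing slip (signs / the `L ≥ 3`
needed for `⌊L/2⌋ ≢ 0`); the mathematics is Byers–Yang gauge covariance. -/
theorem stub_twistCost_of_farCutCurrent {U n β θ₁ : ℝ} (hβ : 0 < β) (hθ₁ : 0 < θ₁)
    (h : PersistentCurrentVanishes U n β θ₁) : TwistInsensitiveAt 0 U n β := by
  sorry

/-- **STUB B (the Capel–Moscolari–Teufel–Wessel port; size L; THE WORK).** Quantum belief propagation on the
sector: `P e^{−β(H₀+W_φ)} P = η (P e^{−βH₀} P) η*` with `η` the `N↑,N↓`-conserving QBP intertwiner of the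
path `H₀ + sW_φ`, `‖η‖ ≤ e^{β‖W_φ‖}`, `‖W_φ‖ ≤ 2L|φ|`; Lieb–Robinson localisation `η_r ∈ carEven(orbSet X_r)`
(`fermion_lieb_robinson_hamiltonianWith`, velocity from `t, U` only) with `X = ` the two seam columns,
`r = L/4`; time reversal `⟨j_{(0,y)}⟩_{H₀} = 0`; then CMTW Thm 14 verbatim gives
`|⟨j_{(0,y)}⟩_{H₀+W_φ}| ≤ 2[e^{4βL|φ|} C (2L·L/2)^{2k} e^{−(L/4)/ξ} + 8βL|φ| ζ(L/4)]`, and the sum over the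
`L` bonds is `≤ ε_L → 0` once `4β|φ| ≤ 4βθ₁ = 1/(16ξ) < 1/(4ξ)`. Why it might fail: the fermionic/sector
version of CMTW Prop. 9–13 (QBP filter bounds) must be re-derived on `Matrix (Finset (Orb _)) _ ℂ`; the
mathematics is in print for spins with the fermionic extension asserted (arXiv:2310.09182 p. 12). -/
theorem stub_farCutCurrent_of_clustering {U n β ξ : ℝ} (hβ : 0 < β)
    (h : CurrentClustering U n β ξ) : PersistentCurrentVanishes U n β (1 / (64 * β * ξ)) := by
  sorry

/-! ## §4 Composition — the route decls BY NAME from Hypothesis C -/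

/-- Hypothesis C at `β` ⇒ twist-insensitivity at `β` (flux window `θ₁ = 1/(64βξ)`). -/
theorem twistInsensitiveAt_of_currentClustering {U n β ξ : ℝ} (hβ : 0 < β)
    (h : CurrentClustering U n β ξ) : TwistInsensitiveAt 0 U n β := by
  have hξ : 0 < ξ := h.1
  exact stub_twistCost_of_farCutCurrent hβ (by positivity) (stub_farCutCurrent_of_clustering hβ h)

/-- **K1′ by name.** Uniform exponential clustering of the flux-free `(N_L,S^z=0)` Gibbs state at
`(t′,U,n,β) = (0,8,7/8,8)` ⇒ `TcThermcert1.ThermalStiffnessCeilingU8b8_le_7o44` (indeed the leaf with `c = 0`). -/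
theorem K1prime_of_currentClustering {ξ : ℝ} (h : CurrentClustering 8 (7 / 8) 8 ξ) :
    Summit.Ventures.CertifiedManyBodySolver.Theses.TcThermcert1.ThermalStiffnessCeilingU8b8_le_7o44 :=
  leafAtBeta_of_twistInsensitiveAt (by norm_num) (by norm_num)
    (twistInsensitiveAt_of_currentClustering (by norm_num) h)

/-- **K1 by name** (same lever at `β·t = 10`; the clustering bet is weaker-supported there, see the card). -/
theorem K1_of_currentClustering {ξ : ℝ} (h : CurrentClustering 8 (7 / 8) 10 ξ) :
    Summit.Ventures.CertifiedManyBodySolver.Theses.TcThermcert1.ThermalStiffnessCeilingU8b10_le_1o8 :=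
  leafAtBeta_of_twistInsensitiveAt (by norm_num) (by norm_num)
    (twistInsensitiveAt_of_currentClustering (by norm_num) h)

/-- The leaf with the FULL margin (`c = 0`) at `β = 8`, recorded to show no constant is spent
(`Disproof.seam_budget`). -/
theorem leaf_c0_of_currentClustering {ξ : ℝ} (h : CurrentClustering 8 (7 / 8) 8 ξ) :
    ObsThermalStiffnessSeqCeilingAtBeta 0 8 (7 / 8) 8 0 :=
  leafAtBeta_of_twistInsensitiveAt (by norm_num) le_rfl
    (twistInsensitiveAt_of_currentClustering (by norm_num) h)

end Summit.Ventures.CertifiedManyBodySolver.Cruxes.ThermalStiffnessCeilingU8b10_le_1o8.GaugeQBP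

end
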